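import Mathlib
import HarnessLib
import Literature.Analysis.Complex.LaplaceDecaySupport
import Literature.Analysis.Complex.GeneralDirichletSeriesFibres
import Summits.AtomisticToContinuum.Crystallization.Theorems.HolmgrenBoyleLindHalfSpaceUniqueContinuationZeroModeLaplace
import Summits.AtomisticToContinuum.Crystallization.Theorems.HolmgrenBoyleLindHalfSpaceUniqueContinuationShellPeelingDecay

/-!
# Route `HolmgrenBoyleLind`: Lennard-Jones force fields of separated sources, part 18b —
shell peeling tools II: decay form of the zero-mode uniqueness lemma, tails and the zero mode

Support file for the crux item stmt-AtomisticToContinuum-6075 (`HalfSpaceUniqueContinuation`, line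
`registered`, layered core, THICK-CLASS PEELING; infrastructure written by a stub-worker of lead c3).
First the abstract setting of part 13 (sources `q`, weights `‖θ q‖ ≤ 1`, heights `y q ≥ 0` with
window count `N`):
* `hbl_zeroMode_fibres_eq_zero_of_decay` — decay form of `hbl_zeroMode_fibres_eq_zero`: if
  `‖∑_q θ q ((X + y_q)⁻⁵/3 − (X + y_q)⁻¹¹/6)‖ ≤ C e^{-κX}` for large `X` (`κ > 0`), the fibres vanish
  (Pólya, `Literature.Analysis.Complex.ae_eq_zero_of_laplace_exp_decay`, kills the density a.e. on
  `[0, κ)`; the polynomial factor is `> 0` on `(0, 1)`; Dirichlet-series uniqueness from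
  `(κ₁/2, κ₁)`, `κ₁ = min κ 1`); `hbl_zeroMode_eq_zero_of_fibres` — the converse bookkeeping.
Then the setting of the shell peeling of part 18 (frequencies `k : K` with radii `ρ k`, `ρ k₀ = 0`,
finite shells, `∑ₖ e^{-ε ρ k} < ∞`, unimodular weights `ψ k`, modes `M k X = ∑_q θ k q 𝔪ₖ(X + y q)`
with the inline two-kernel / zero-mode profiles, `∑ₖ ψ k M k X = 0` for `X ≥ T ≥ t₀ + 3`):
* `hbl_peel_tail_decay` — for `s ≥ 0`, `‖∑_{ρ k ≤ s} ψ k M k X‖ ≤ C e^{-κX}` with `κ = 2πs⁺ > 2πs`,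
  `s⁺` the next radius (`Finset.hasSum_compl_iff`, `hbl_peel_exists_mode_bound`, `∑ₖ e^{-2πρ k} < ∞`);
* `hbl_peel_zeroMode` — hence, if `c₀ ≠ 0`, the height fibres of `θ k₀` vanish
  (`hbl_zeroMode_fibres_eq_zero_of_decay`), and in any case `M k₀ X = 0` for `X ≥ T`.
All `[folklore]`; nothing here closes an item.
-/

noncomputable section

namespace Summit.AtomisticToContinuum.Crystallization.Theorems.HolmgrenBoyleLind

open scoped BigOperators Topology
open MeasureTheory Filter Set Literature.Analysis.SpecialFunctions

section ZeroMode

variable {ι : Type*} [Countable ι] {θ : ι → ℂ} {y : ι → ℝ} {N : ℕ}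

/-! ## The zero mode: decay form of the uniqueness lemma -/

/-- `Γ(5) = 24` and `Γ(11) = 3628800`. [folklore] -/
private theorem hbl_pd_Gamma_values : Real.Gamma 5 = 24 ∧ Real.Gamma 11 = 3628800 := by
  rw [show (5 : ℝ) = (4 : ℕ) + 1 by norm_num, show (11 : ℝ) = (10 : ℕ) + 1 by norm_num,
    Real.Gamma_nat_eq_factorial, Real.Gamma_nat_eq_factorial]
  norm_num [Nat.factorial]

/-- The polynomial factor `l⁴/(3Γ(5)) − l¹⁰/(6Γ(11))` is positive on `(0, 1)`. [folklore] -/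
private theorem hbl_pd_kernel_pos {l : ℝ} (h0 : 0 < l) (h1 : l < 1) :
    0 < l ^ 4 / (3 * Real.Gamma 5) - l ^ 10 / (6 * Real.Gamma 11) := by
  rw [hbl_pd_Gamma_values.1, hbl_pd_Gamma_values.2]
  have h4 : 0 < l ^ 4 := by positivity
  nlinarith [mul_pos h4 (sub_pos.2 (pow_lt_one₀ h0.le h1 (by norm_num : (6 : ℕ) ≠ 0)))]

omit [Countable ι] in
/-- Window count: `q ↦ ‖θ q‖ e^{-s (y_q + t₀)}` is summable for `s > 0`. [folklore] -/
private theorem hbl_pd_summable_shift (hθ : ∀ q, ‖θ q‖ ≤ 1) (hy : ∀ q, 0 ≤ y q)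
    (hN : ∀ j : ℕ, {q : ι | (j : ℝ) ≤ y q ∧ y q ≤ j + 1}.encard ≤ N) (t₀ : ℝ) {s : ℝ}
    (hs : 0 < s) : Summable fun q => ‖θ q‖ * Real.exp (-(s * (y q + t₀))) := by
  refine ((hbl_shellSeries_summable hθ hy hN hs).1.mul_left (Real.exp (-(s * t₀)))).congr
    fun q => ?_
  rw [mul_left_comm, ← Real.exp_add]
  ring_nf

/-- **Uniqueness for the zero mode, decay form.** If
`‖∑_q θ q ((X + y_q)⁻⁵/3 − (X + y_q)⁻¹¹/6)‖ ≤ C e^{-κX}` for all `X ≥ X₁` (`κ, X₁ > 0`), then every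
height fibre `∑_{q : y_q = η} θ q` vanishes. (With `t₀ = X₁/2` the zero mode at depth `X + t₀` is
`∫₀^∞ e^{-lX} ρ(l) dl`; Pólya's theorem `ae_eq_zero_of_laplace_exp_decay` gives `ρ = 0` a.e. on
`(0, κ)`, hence on `(0, κ)` by continuity; the polynomial factor is `> 0` on `(0, 1)`, so the
Dirichlet series `∑_q θ q e^{-(y_q + t₀)s}` vanishes on `(κ₁/2, κ₁)`, `κ₁ = min κ 1`; then
`generalDirichlet_hasSum_zero_of_eqOn_Ioo`, `fibre_sum_eq_zero_of_generalDirichlet_hasSum_zero`.)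
[folklore] -/
theorem hbl_zeroMode_fibres_eq_zero_of_decay (hθ : ∀ q, ‖θ q‖ ≤ 1) (hy : ∀ q, 0 ≤ y q)
    (hN : ∀ j : ℕ, {q : ι | (j : ℝ) ≤ y q ∧ y q ≤ j + 1}.encard ≤ N) {κ C X₁ : ℝ} (hκ : 0 < κ)
    (hX₁ : 0 < X₁)
    (hdecay : ∀ X : ℝ, X₁ ≤ X →
      ‖∑' q, θ q * ((((X + y q)⁻¹ ^ 5 / 3 - (X + y q)⁻¹ ^ 11 / 6 : ℝ)) : ℂ)‖ ≤
        C * Real.exp (-κ * X))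
    (η : ℝ) : ∑ q ∈ (hbl_shell_heights_finite hN hy η).toFinset with y q = η, θ q = 0 := by
  -- adapted from `hbl_zeroMode_fibres_eq_zero` (…ZeroModeLaplace): genuine decay bound
  set t₀ : ℝ := X₁ / 2 with ht₀def
  have ht₀ : 0 < t₀ := by positivity
  obtain ⟨hint, hcont⟩ := hbl_zeroModeDensity_integrable hθ hy hN ht₀
  -- the Laplace transform of `ρ` decays for `X ≥ X₁ - t₀`
  have hG : ∀ X : ℝ, X₁ - t₀ ≤ X → ‖∫ l in Ioi (0 : ℝ), Complex.exp (-((l * X : ℝ) : ℂ)) *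
      ((∑' q, θ q * Complex.exp (-(((y q + t₀) * l : ℝ) : ℂ))) *
        (((l ^ 4 / (3 * Real.Gamma 5) - l ^ 10 / (6 * Real.Gamma 11) : ℝ)) : ℂ))‖ ≤
      C * Real.exp (-κ * t₀) * Real.exp (-κ * X) := by
    intro X hX
    have hX0 : 0 < X := by rw [ht₀def] at hX; linarith
    rw [← (hbl_hasSum_zeroMode_eq_laplace hθ hy hN ht₀ hX0).tsum_eq]
    have h := hdecay (X + t₀) (by linarith)
    have hfun : ∀ q, X + t₀ + y q = X + y q + t₀ := fun q => by ring
    simp_rw [hfun] at h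
    refine h.trans_eq ?_
    rw [mul_assoc, ← Real.exp_add]
    ring_nf
  set ρ : ℝ → ℂ := fun l : ℝ => (∑' q, θ q * Complex.exp (-(((y q + t₀) * l : ℝ) : ℂ))) *
    (((l ^ 4 / (3 * Real.Gamma 5) - l ^ 10 / (6 * Real.Gamma 11) : ℝ)) : ℂ) with hρ
  set m : ℝ → ℂ := (Ioi (0 : ℝ)).indicator ρ with hm
  have hm_int : Integrable m := (integrable_indicator_iff measurableSet_Ioi).2 hint
  have hm_supp : ∀ᵐ t ∂volume, t < 0 → m t = 0 := Eventually.of_forall fun t ht =>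
    Set.indicator_of_notMem (fun h : t ∈ Ioi (0 : ℝ) => (lt_asymm h ht).elim) _
  have hm_lap : ∀ X : ℝ, X₁ - t₀ ≤ X →
      ‖∫ t : ℝ, Complex.exp (-(t : ℂ) * X) * m t‖ ≤ C * Real.exp (-κ * t₀) * Real.exp (-κ * X) := by
    intro X hX
    have h1 : ∫ t : ℝ, Complex.exp (-(t : ℂ) * X) * m t =
        ∫ t in Ioi (0 : ℝ), Complex.exp (-((t * X : ℝ) : ℂ)) *
          ((∑' q, θ q * Complex.exp (-(((y q + t₀) * t : ℝ) : ℂ))) *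
            (((t ^ 4 / (3 * Real.Gamma 5) - t ^ 10 / (6 * Real.Gamma 11) : ℝ)) : ℂ)) := by
      rw [← integral_indicator measurableSet_Ioi]
      refine integral_congr_ae (Eventually.of_forall fun t => ?_)
      show Complex.exp (-(t : ℂ) * X) * m t =
        (Ioi (0 : ℝ)).indicator (fun t => Complex.exp (-((t * X : ℝ) : ℂ)) * ρ t) t
      rw [Set.indicator_mul_right, Complex.ofReal_mul, neg_mul]
    rw [h1]
    exact hG X hX
  have hae : ∀ᵐ t ∂volume, t < κ → m t = 0 :=
    Literature.Analysis.Complex.ae_eq_zero_of_laplace_exp_decay hm_int hm_supp hκ hm_lap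
  -- `ρ = 0` on `(0, κ)` by continuity
  have hρ0 : EqOn ρ 0 (Ioo 0 κ) := by
    refine Measure.eqOn_open_of_ae_eq (μ := volume) ?_ isOpen_Ioo
      (hcont.mono Ioo_subset_Ioi_self) continuousOn_const
    rw [EventuallyEq, ae_restrict_iff' measurableSet_Ioo]
    filter_upwards [hae] with t ht hmem
    have h := ht hmem.2
    rwa [hm, Set.indicator_of_mem (show t ∈ Ioi (0 : ℝ) from hmem.1)] at h
  -- the Dirichlet series with exponents `y q + t₀` vanishes on `(κ₁/2, κ₁)`, `κ₁ = min κ 1`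
  have hκ₁ : 0 < min κ 1 := lt_min hκ one_pos
  have hsum : Summable fun q => ‖θ q‖ * Real.exp (-(min κ 1 / 4 * (y q + t₀))) :=
    hbl_pd_summable_shift hθ hy hN t₀ (by positivity)
  have hS0 : ∀ s : ℝ, s ∈ Set.Ioo (min κ 1 / 2) (min κ 1) →
      HasSum (fun q => θ q * Complex.exp (-(((y q + t₀ : ℝ) : ℂ) * s))) 0 := by
    intro s hs
    have hs0 : 0 < s := by linarith [hs.1]
    have hs1 : s < 1 := hs.2.trans_le (min_le_right _ _)
    have hsκ : s < κ := hs.2.trans_le (min_le_left _ _)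
    have hsm : Summable fun q => θ q * Complex.exp (-(((y q + t₀) * s : ℝ) : ℂ)) :=
      .of_norm_bounded (hbl_pd_summable_shift hθ hy hN t₀ hs0) fun q => by
        rw [norm_mul, ← Complex.ofReal_neg, Complex.norm_exp_ofReal, mul_comm (y q + t₀) s]
    have hval : ∑' q, θ q * Complex.exp (-(((y q + t₀) * s : ℝ) : ℂ)) = 0 := by
      have h := hρ0 ⟨hs0, hsκ⟩
      simp only [hρ, Pi.zero_apply, mul_eq_zero, Complex.ofReal_eq_zero] at h
      exact h.resolve_right (hbl_pd_kernel_pos hs0 hs1).ne'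
    have hfun : ∀ q, θ q * Complex.exp (-(((y q + t₀ : ℝ) : ℂ) * s)) =
        θ q * Complex.exp (-(((y q + t₀) * s : ℝ) : ℂ)) := fun q => by push_cast; ring_nf
    simp_rw [hfun]
    exact hval ▸ hsm.hasSum
  have hall := Literature.Analysis.Complex.generalDirichlet_hasSum_zero_of_eqOn_Ioo
    (y := fun q => y q + t₀) (fun q => by linarith [hy q]) hsum
    (by linarith : min κ 1 / 4 < min κ 1 / 2) (by linarith) hS0
  have hfin' : ∀ Y : ℝ, {q : ι | y q + t₀ ≤ Y}.Finite := fun Y =>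
    (hbl_shell_heights_finite hN hy (Y - t₀)).subset fun q (hq : y q + t₀ ≤ Y) => by
      show y q ≤ Y - t₀; linarith
  have hfib := Literature.Analysis.Complex.fibre_sum_eq_zero_of_generalDirichlet_hasSum_zero
    hfin' le_rfl hsum hall (η + t₀)
  have hF : ((hfin' (η + t₀)).toFinset.filter fun i => y i + t₀ = η + t₀) =
      ((hbl_shell_heights_finite hN hy η).toFinset.filter fun q => y q = η) := by
    ext q
    simp only [Finset.mem_filter, Set.Finite.mem_toFinset, Set.mem_setOf_eq,
      add_le_add_iff_right, add_left_inj]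
  rw [← hF]
  exact hfib

/-- **Vanishing fibres kill the zero mode.** If every height fibre `∑_{q : y_q = η} θ q` vanishes
then `∑_q θ q ((X + y_q)⁻⁵/3 − (X + y_q)⁻¹¹/6) = 0` for every `X > 0` (absolute convergence from
`hbl_hasSum_zeroMode_eq_laplace`, regrouping by `hbl_tsum_eq_zero_of_fibres`). [folklore] -/
theorem hbl_zeroMode_eq_zero_of_fibres (hθ : ∀ q, ‖θ q‖ ≤ 1) (hy : ∀ q, 0 ≤ y q)
    (hN : ∀ j : ℕ, {q : ι | (j : ℝ) ≤ y q ∧ y q ≤ j + 1}.encard ≤ N)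
    (hfib : ∀ η : ℝ, ∑ q ∈ (hbl_shell_heights_finite hN hy η).toFinset with y q = η, θ q = 0)
    {X : ℝ} (hX : 0 < X) :
    ∑' q, θ q * ((((X + y q)⁻¹ ^ 5 / 3 - (X + y q)⁻¹ ^ 11 / 6 : ℝ)) : ℂ) = 0 := by
  have hs : Summable fun q => θ q * ((((X + y q)⁻¹ ^ 5 / 3 - (X + y q)⁻¹ ^ 11 / 6 : ℝ)) : ℂ) :=
    (hbl_hasSum_zeroMode_eq_laplace hθ hy hN (half_pos hX) (half_pos hX)).summable.congr
      fun q => by rw [show X / 2 + y q + X / 2 = X + y q by ring]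
  exact hbl_tsum_eq_zero_of_fibres (hbl_shell_heights_finite hN hy)
    (fun t => ((((X + t)⁻¹ ^ 5 / 3 - (X + t)⁻¹ ^ 11 / 6 : ℝ)) : ℂ)) hs hfib

end ZeroMode

section Peel

variable {K R : Type*} [Countable R] [DecidableEq K] {k₀ : K} {ρ : K → ℝ} {ψ : K → ℂ}
  {θ : K → R → ℂ} {y : R → ℝ} {N : ℕ} {ν₁ ν₂ c₀ : ℝ} {a b : ℝ → ℝ} {A t₀ T : ℝ}
  {M : K → ℝ → ℂ}

/-- **The shells beyond radius `s` are exponentially small beyond the rate `2πs`.** If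
`∑ₖ ψ k · M k X = 0` for `X ≥ T` then for every `s ≥ 0` there are `κ > 2πs` and `C` with
`‖∑_{ρ k ≤ s} ψ k · M k X‖ ≤ C e^{-κX}` for `X ≥ T`: the finite part is minus the tail
(`Finset.hasSum_compl_iff`), every tail mode has radius `≥ s⁺ = min {ρ k > s}` (local finiteness)
and is bounded by `hbl_peel_exists_mode_bound`, and `∑ₖ e^{-2π ρ k} < ∞`; `κ = 2π s⁺`.
[folklore] -/
theorem hbl_peel_tail_decay (hρ0 : ρ k₀ = 0) (hfin : ∀ C : ℝ, {k : K | ρ k ≤ C}.Finite)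
    (hexp : ∀ ε : ℝ, 0 < ε → Summable fun k : K => Real.exp (-(ε * ρ k)))
    (hψ : ∀ k, ‖ψ k‖ = 1) (hθ : ∀ k q, ‖θ k q‖ ≤ 1) (hy : ∀ q, 0 ≤ y q)
    (hN : ∀ j : ℕ, {q : R | (j : ℝ) ≤ y q ∧ y q ≤ j + 1}.encard ≤ N)
    (hab : ∀ r, 0 < r → |a r| ≤ A * Real.exp r ∧ |b r| ≤ A * Real.exp r)
    (ht₀ : 0 < t₀) (hT : t₀ + 3 ≤ T)
    (hM : ∀ (k : K) (X : ℝ), M k X = ∑' q, θ k q *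
      (if k = k₀ then
        ((c₀ * (-(Real.pi * ((X + y q)⁻¹ ^ 5 / 3 - (X + y q)⁻¹ ^ 11 / 6))) : ℝ) : ℂ)
      else
        ((a (ρ k) * (((X + y q) ^ (-(2 : ℝ)) : ℝ) *
              ∫ u : ℝ, Real.exp (ν₁ * u - 2 * Real.pi * ρ k * (X + y q) * Real.cosh u)) +
          b (ρ k) * (((X + y q) ^ (-(5 : ℝ)) : ℝ) *
              ∫ u : ℝ, Real.exp (ν₂ * u - 2 * Real.pi * ρ k * (X + y q) * Real.cosh u)) :
          ℝ) : ℂ)))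
    (hM0 : ∀ X : ℝ, T ≤ X → HasSum (fun k : K => ψ k * M k X) 0) {s : ℝ} (hs : 0 ≤ s) :
    ∃ κ C : ℝ, 2 * Real.pi * s < κ ∧ ∀ X : ℝ, T ≤ X →
      ‖∑ k ∈ (hfin s).toFinset, ψ k * M k X‖ ≤ C * Real.exp (-κ * X) := by
  -- the finite part is minus the tail
  have htail : ∀ X : ℝ, T ≤ X → ∑ k ∈ (hfin s).toFinset, ψ k * M k X =
      -∑' k : {k // k ∉ (hfin s).toFinset}, ψ k * M k X := by
    intro X hX
    have h2 : HasSum (fun k : {k // k ∉ (hfin s).toFinset} => ψ k * M k X)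
        (-∑ k ∈ (hfin s).toFinset, ψ k * M k X) :=
      ((hfin s).toFinset.hasSum_compl_iff (f := fun k : K => ψ k * M k X)
        (a := -∑ k ∈ (hfin s).toFinset, ψ k * M k X)).2
        (by rw [neg_add_cancel]; exact hM0 X hX)
    rw [h2.tsum_eq, neg_neg]
  by_cases hempty : ∀ k, ρ k ≤ s
  · refine ⟨2 * Real.pi * s + 1, 0, by linarith, fun X hX => ?_⟩
    haveI : IsEmpty {k // k ∉ (hfin s).toFinset} :=
      ⟨fun k => k.2 ((hfin s).mem_toFinset.2 (hempty k))⟩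
    rw [htail X hX, tsum_empty, neg_zero, norm_zero, zero_mul]
  simp only [not_forall, not_le] at hempty
  obtain ⟨k₁, hk₁⟩ := hempty
  -- the next radius `ρ k₂ = min {ρ k | ρ k > s}`
  obtain ⟨k₂, hk₂, hmin⟩ := ((hfin (ρ k₁)).toFinset.filter fun k => s < ρ k).exists_min_image ρ
    ⟨k₁, Finset.mem_filter.2 ⟨(hfin _).mem_toFinset.2 (le_refl (ρ k₁)), hk₁⟩⟩
  have hk₂s : s < ρ k₂ := (Finset.mem_filter.1 hk₂).2
  have hnext : ∀ k, s < ρ k → ρ k₂ ≤ ρ k := fun k hk => by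
    rcases le_or_gt (ρ k) (ρ k₁) with h | h
    · exact hmin k (Finset.mem_filter.2 ⟨(hfin _).mem_toFinset.2 h, hk⟩)
    · exact (hmin k₁ (Finset.mem_filter.2 ⟨(hfin _).mem_toFinset.2 (le_refl (ρ k₁)),
        hk₁⟩)).trans h.le
  have hr' : 0 < ρ k₂ := hs.trans_lt hk₂s
  obtain ⟨D, hD0, hD⟩ := hbl_peel_exists_mode_bound hy hN ν₁ ν₂ A hr' ht₀ hT
  have hS := hexp (2 * Real.pi) (by positivity)
  refine ⟨2 * Real.pi * ρ k₂, D * ∑' k, Real.exp (-(2 * Real.pi * ρ k)),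
    by nlinarith [Real.pi_pos], fun X hX => ?_⟩
  -- termwise bound in the tail
  have hkey : ∀ k : {k // k ∉ (hfin s).toFinset}, ‖ψ k * M k X‖ ≤
      D * Real.exp (-(2 * Real.pi * ρ k₂) * X) * Real.exp (-(2 * Real.pi * ρ k)) := by
    intro k
    have hsk : s < ρ k := not_le.1 fun h => k.2 ((hfin s).mem_toFinset.2 h)
    have hrk : 0 < ρ k := hs.trans_lt hsk
    have hk0 : (k : K) ≠ k₀ := fun h => by rw [h, hρ0] at hrk; exact lt_irrefl _ hrk
    rw [norm_mul, hψ, one_mul, hM k X]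
    simp only [if_neg hk0]
    exact hD (θ k) (hθ k) (a (ρ k)) (b (ρ k)) (ρ k) X (hnext k hsk) hX (hab _ hrk).1 (hab _ hrk).2
  have hSc : Summable fun k : {k // k ∉ (hfin s).toFinset} => Real.exp (-(2 * Real.pi * ρ k)) :=
    ((hfin s).toFinset.summable_compl_iff (f := fun k : K => Real.exp (-(2 * Real.pi * ρ k)))).2
      hS
  have hle : ∑' k : {k // k ∉ (hfin s).toFinset}, Real.exp (-(2 * Real.pi * ρ k)) ≤
      ∑' k, Real.exp (-(2 * Real.pi * ρ k)) :=
    hasSum_le_inj (f := fun k : {k // k ∉ (hfin s).toFinset} => Real.exp (-(2 * Real.pi * ρ k)))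
      (g := fun k : K => Real.exp (-(2 * Real.pi * ρ k))) Subtype.val Subtype.val_injective
      (fun c _ => (Real.exp_pos _).le) (fun _ => le_rfl) hSc.hasSum hS.hasSum
  calc ‖∑ k ∈ (hfin s).toFinset, ψ k * M k X‖
      = ‖∑' k : {k // k ∉ (hfin s).toFinset}, ψ k * M k X‖ := by rw [htail X hX, norm_neg]
    _ ≤ ∑' k : {k // k ∉ (hfin s).toFinset},
          D * Real.exp (-(2 * Real.pi * ρ k₂) * X) * Real.exp (-(2 * Real.pi * ρ k)) :=
        tsum_of_norm_bounded (hSc.mul_left _).hasSum hkey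
    _ = D * Real.exp (-(2 * Real.pi * ρ k₂) * X) *
          ∑' k : {k // k ∉ (hfin s).toFinset}, Real.exp (-(2 * Real.pi * ρ k)) := tsum_mul_left
    _ ≤ D * Real.exp (-(2 * Real.pi * ρ k₂) * X) * ∑' k, Real.exp (-(2 * Real.pi * ρ k)) :=
        mul_le_mul_of_nonneg_left hle (by positivity)
    _ = D * (∑' k, Real.exp (-(2 * Real.pi * ρ k))) * Real.exp (-(2 * Real.pi * ρ k₂) * X) := by
        ring

/-- **Peeling the zero mode.** Under the identically vanishing mode sum, (i) if `c₀ ≠ 0` every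
height fibre of `θ k₀` vanishes, and (ii) the zero mode `M k₀ X` vanishes for `X ≥ T`: the zero
mode is minus the tail beyond radius `0`, which is `O(e^{-κX})` with `κ > 0`
(`hbl_peel_tail_decay`), `‖ψ k₀‖ = 1`, and `M k₀ X = -c₀π · ∑_q θ k₀ q ((X + y_q)⁻⁵/3 − (X + y_q)⁻¹¹/6)`,
so `hbl_zeroMode_fibres_eq_zero_of_decay` and `hbl_zeroMode_eq_zero_of_fibres` apply. [folklore] -/
theorem hbl_peel_zeroMode (hρ0 : ρ k₀ = 0) (hρ : ∀ k, k ≠ k₀ → 0 < ρ k)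
    (hfin : ∀ C : ℝ, {k : K | ρ k ≤ C}.Finite)
    (hexp : ∀ ε : ℝ, 0 < ε → Summable fun k : K => Real.exp (-(ε * ρ k)))
    (hψ : ∀ k, ‖ψ k‖ = 1) (hθ : ∀ k q, ‖θ k q‖ ≤ 1) (hy : ∀ q, 0 ≤ y q)
    (hN : ∀ j : ℕ, {q : R | (j : ℝ) ≤ y q ∧ y q ≤ j + 1}.encard ≤ N)
    (hab : ∀ r, 0 < r → |a r| ≤ A * Real.exp r ∧ |b r| ≤ A * Real.exp r)
    (ht₀ : 0 < t₀) (hT : t₀ + 3 ≤ T)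
    (hM : ∀ (k : K) (X : ℝ), M k X = ∑' q, θ k q *
      (if k = k₀ then
        ((c₀ * (-(Real.pi * ((X + y q)⁻¹ ^ 5 / 3 - (X + y q)⁻¹ ^ 11 / 6))) : ℝ) : ℂ)
      else
        ((a (ρ k) * (((X + y q) ^ (-(2 : ℝ)) : ℝ) *
              ∫ u : ℝ, Real.exp (ν₁ * u - 2 * Real.pi * ρ k * (X + y q) * Real.cosh u)) +
          b (ρ k) * (((X + y q) ^ (-(5 : ℝ)) : ℝ) *
              ∫ u : ℝ, Real.exp (ν₂ * u - 2 * Real.pi * ρ k * (X + y q) * Real.cosh u)) :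
          ℝ) : ℂ)))
    (hM0 : ∀ X : ℝ, T ≤ X → HasSum (fun k : K => ψ k * M k X) 0) :
    (c₀ ≠ 0 → ∀ η : ℝ,
      ∑ q ∈ (hbl_shell_heights_finite hN hy η).toFinset with y q = η, θ k₀ q = 0) ∧
      ∀ X : ℝ, T ≤ X → M k₀ X = 0 := by
  obtain ⟨κ, C, hκ, hdec⟩ :=
    hbl_peel_tail_decay hρ0 hfin hexp hψ hθ hy hN hab ht₀ hT hM hM0 le_rfl
  have hκ0 : 0 < κ := by simpa using hκ
  have hT0 : 0 < T := by linarith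
  -- the finite part below radius `0` is the zero mode alone
  have hsingle : ∀ X, ∑ k ∈ (hfin 0).toFinset, ψ k * M k X = ψ k₀ * M k₀ X := fun X => by
    refine Finset.sum_eq_single_of_mem k₀ ((hfin 0).mem_toFinset.2 (le_of_eq hρ0))
      fun k hk hne => ?_
    exact absurd ((hfin 0).mem_toFinset.1 hk) (not_le.2 (hρ k hne))
  have hMZ : ∀ X, M k₀ X = ((-(c₀ * Real.pi) : ℝ) : ℂ) *
      ∑' q, θ k₀ q * ((((X + y q)⁻¹ ^ 5 / 3 - (X + y q)⁻¹ ^ 11 / 6 : ℝ)) : ℂ) := fun X => by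
    rw [hM k₀ X, ← tsum_mul_left]
    simp only [if_true]
    refine tsum_congr fun q => ?_
    push_cast
    ring
  have hZdec : ∀ X, T ≤ X → |c₀| * Real.pi *
      ‖∑' q, θ k₀ q * ((((X + y q)⁻¹ ^ 5 / 3 - (X + y q)⁻¹ ^ 11 / 6 : ℝ)) : ℂ)‖ ≤
        C * Real.exp (-κ * X) := fun X hX => by
    have h := hdec X hX
    rwa [hsingle, norm_mul, hψ, one_mul, hMZ, norm_mul, Complex.norm_real, Real.norm_eq_abs,
      abs_neg, abs_mul, abs_of_pos Real.pi_pos] at h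
  by_cases hc₀ : c₀ = 0
  · refine ⟨fun h => absurd hc₀ h, fun X _ => ?_⟩
    rw [hMZ, hc₀]
    simp
  have hpos : 0 < |c₀| * Real.pi := by positivity
  have hfib : ∀ η : ℝ,
      ∑ q ∈ (hbl_shell_heights_finite hN hy η).toFinset with y q = η, θ k₀ q = 0 :=
    hbl_zeroMode_fibres_eq_zero_of_decay (hθ k₀) hy hN hκ0 hT0 (C := C / (|c₀| * Real.pi))
      fun X hX => by
        rw [div_mul_eq_mul_div, le_div_iff₀ hpos, mul_comm]
        exact hZdec X hX
  exact ⟨fun _ => hfib, fun X hX => by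
    rw [hMZ, hbl_zeroMode_eq_zero_of_fibres (hθ k₀) hy hN hfib (hT0.trans_le hX), mul_zero]⟩

end Peel

end Summit.AtomisticToContinuum.Crystallization.Theorems.HolmgrenBoyleLind

end
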